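import Summits.Ventures.YMGap.RobustBall.FourPointDecayS
import HarnessLib

/-!
# Venture YMGap, track ROBUST-BALL (Y2) — TIER 2: TREE DECAY OF THE FOURTH CUMULANT — `SU(2)`, `ℤ⁴` HYPOTHESIS-FREE CELLS

HONEST FRAMING. WHAT THIS IS: a venture file (cell `pub-ymgap`, track Y2 ROBUST-BALL, seat rb-p1, theorems only): the hypothesis-free `SU(2)`, `ℤ⁴` cells of
`FourPointDecayS.abs_fourPoint_le_tree_S` (one-link input `oneLinkPoincareSUN_two_sharp`, `c = 2/3`):
* `su2_abs_fourPoint_le_tree_dim4` — every member `W ∈ MemBallZdS a Λ t` inside the door `6|β_W| e^{a} e^{t} + e^{a/2}√(2/3) Λ < 1` (`t ≥ 0`, bare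
  coupling `β_W/2`), EVERY DLR state, Lipschitz cylinders `F, G, H, K` bounded by `M_•`:
  `|u₄(F; G; H; K)| ≤ 96 · B₄ · Σ_{16 spanning trees} Π_{e} e^{−(t/3) d_e}` with `B₄` the seven-split coefficient at `S_• = #Λ_• K_•`;
* ★ `su2_wilson_abs_fourPoint_le_tree` — THE `SU(2)` WILSON STATE ON `ℤ⁴` (member `W = 0`): for every `β_W` and `t ≥ 0` with `6|β_W| e^{t} < 1` (so every
  `|β_W| < 1/6`, with rate `t < log(1/(6|β_W|))`), every DLR state at bare coupling `β_W/2`: the same tree decay of `u₄` of four Lipschitz cylinders.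
Relation to ds-1: `Thresholds/ConnectedFourPointDecay` gives the plaquette `u₄` decay on `0 ≤ β_W ≤ 9/25` by the star-window route; new here = arbitrary Lipschitz
cylinders, the two-sided window `|β_W| < 1/6`, every member of the ball.
WHAT THIS IS NOT: one-sided Dobrushin-comparison constants; nothing about the continuum limit or a Clay-sense mass gap.
-/

noncomputable section

open MeasureTheory Function Finset ProbabilityTheory Real
open scoped NNReal
open Literature.Probability.LatticeModels
open Literature.Probability.LatticeModels.DobrushinMetric
open Literature.MathematicalPhysics.QuantumLattice
open Literature.MathematicalPhysics.QuantumFieldTheory hiding ZdEdge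
open Summit.QuantumFields.BalabanUV.InfraRed.StrongCouplingPoincareDoorSUN (oneLinkPoincareSUN_two_sharp)

namespace Summit.Ventures.YMGap.RobustBall

/-- Local shorthand: the connected three-point function `u₃(X; Y; Z)` under `μ`. -/
local notation3 (prettyPrint := false) "U₃[" X ";" Y ";" Z ";" μ "]" =>
  cov[fun ω => X ω * Y ω, Z; μ] - (∫ ω, X ω ∂μ) * cov[Y, Z; μ] - (∫ ω, Y ω ∂μ) * cov[X, Z; μ]

/-- Local shorthand: the connected four-point function in derivative form `u₄(X; Y; Z; W)` under `μ`. -/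
local notation3 (prettyPrint := false) "U₄[" X ";" Y ";" Z ";" W' ";" μ "]" =>
  (cov[fun ω => (X ω * Y ω) * Z ω, W'; μ] - (∫ ω, X ω * Y ω ∂μ) * cov[Z, W'; μ] - (∫ ω, Z ω ∂μ) * cov[fun ω => X ω * Y ω, W'; μ])
  - cov[X, W'; μ] * cov[Y, Z; μ] - (∫ ω, X ω ∂μ) * U₃[Y ; Z ; W' ; μ]
  - cov[Y, W'; μ] * cov[X, Z; μ] - (∫ ω, Y ω ∂μ) * U₃[X ; Z ; W' ; μ]

/-- **`SU(2)`, `ℤ⁴` — TREE DECAY OF THE FOURTH CUMULANT OF LIPSCHITZ CYLINDERS, uniformly on `MemBallZdS a Λ t`** (`0 ≤ t`,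
`6|β_W| e^{a} e^{t} + e^{a/2} √(2/3) Λ < 1`, bare coupling `β_W/2`, EVERY DLR `μ`, cylinders `F, G, H, K` bounded by `M_•`; constant `96 B₄`). -/
theorem su2_abs_fourPoint_le_tree_dim4 {βW a Λ t : ℝ} (ht : 0 ≤ t)
    (hρ : 6 * |βW| * (exp a * exp t) + exp (a / 2) * Real.sqrt (2 / 3) * Λ < 1)
    {W : Potential (ZdEdge 4) (Matrix.specialUnitaryGroup (Fin 2) ℂ)} (hW : MemBallZdS a Λ t W)
    {μ : Measure (LGConfig 4 (Matrix.specialUnitaryGroup (Fin 2) ℂ))}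
    (hμ : μ ∈ perturbedGibbsMeasuresS (d := 4) (fundamentalRep (Fin 2)) (2 * (βW / 4)) W)
    {F : LGConfig 4 (Matrix.specialUnitaryGroup (Fin 2) ℂ) → ℝ} {ΛF : Finset (ZdEdge 4)} {KF : ℝ≥0}
    (hF : IsLipschitzCylinder (fundamentalRep (Fin 2)) F ΛF KF) {MF : ℝ} (hMF : ∀ σ, |F σ| ≤ MF)
    {G : LGConfig 4 (Matrix.specialUnitaryGroup (Fin 2) ℂ) → ℝ} {ΛG : Finset (ZdEdge 4)} {KG : ℝ≥0}
    (hG : IsLipschitzCylinder (fundamentalRep (Fin 2)) G ΛG KG) {MG : ℝ} (hMG : ∀ σ, |G σ| ≤ MG)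
    {H : LGConfig 4 (Matrix.specialUnitaryGroup (Fin 2) ℂ) → ℝ} {ΛH : Finset (ZdEdge 4)} {KH : ℝ≥0}
    (hH : IsLipschitzCylinder (fundamentalRep (Fin 2)) H ΛH KH) {MH : ℝ} (hMH : ∀ σ, |H σ| ≤ MH)
    {K : LGConfig 4 (Matrix.specialUnitaryGroup (Fin 2) ℂ) → ℝ} {ΛK : Finset (ZdEdge 4)} {KK : ℝ≥0}
    (hK : IsLipschitzCylinder (fundamentalRep (Fin 2)) K ΛK KK) {MK : ℝ} (hMK : ∀ σ, |K σ| ≤ MK) :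
    |U₄[F ; G ; H ; K ; μ]| ≤
      96 * ((MF * MG * (ΛH.card * KH) + MF * MH * (ΛG.card * KG) + MG * MH * (ΛF.card * KF)) * (ΛK.card * KK) +
        (MF * MG * (ΛK.card * KK) + MF * MK * (ΛG.card * KG) + MG * MK * (ΛF.card * KF)) * (ΛH.card * KH) +
        (MF * MH * (ΛK.card * KK) + MF * MK * (ΛH.card * KH) + MH * MK * (ΛF.card * KF)) * (ΛG.card * KG) +
        (MG * MH * (ΛK.card * KK) + MG * MK * (ΛH.card * KH) + MH * MK * (ΛG.card * KG)) * (ΛF.card * KF) +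
        (MF * (ΛG.card * KG) + MG * (ΛF.card * KF)) * (MH * (ΛK.card * KK) + MK * (ΛH.card * KH)) + (MF * (ΛH.card * KH) + MH * (ΛF.card * KF)) * (MG * (ΛK.card * KK) + MK * (ΛG.card * KG)) + (MF * (ΛK.card * KK) + MK * (ΛF.card * KF)) * (MG * (ΛH.card * KH) + MH * (ΛG.card * KG))) *
      (exp (-(t / 3 * setDistEdges ΛF ΛG)) * exp (-(t / 3 * setDistEdges ΛF ΛH)) * exp (-(t / 3 * setDistEdges ΛF ΛK)) +
      exp (-(t / 3 * setDistEdges ΛF ΛG)) * exp (-(t / 3 * setDistEdges ΛG ΛH)) * exp (-(t / 3 * setDistEdges ΛG ΛK)) +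
      exp (-(t / 3 * setDistEdges ΛF ΛH)) * exp (-(t / 3 * setDistEdges ΛG ΛH)) * exp (-(t / 3 * setDistEdges ΛH ΛK)) +
      exp (-(t / 3 * setDistEdges ΛF ΛK)) * exp (-(t / 3 * setDistEdges ΛG ΛK)) * exp (-(t / 3 * setDistEdges ΛH ΛK)) +
      exp (-(t / 3 * setDistEdges ΛF ΛG)) * exp (-(t / 3 * setDistEdges ΛG ΛH)) * exp (-(t / 3 * setDistEdges ΛH ΛK)) +
      exp (-(t / 3 * setDistEdges ΛF ΛG)) * exp (-(t / 3 * setDistEdges ΛG ΛK)) * exp (-(t / 3 * setDistEdges ΛH ΛK)) +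
      exp (-(t / 3 * setDistEdges ΛF ΛH)) * exp (-(t / 3 * setDistEdges ΛG ΛH)) * exp (-(t / 3 * setDistEdges ΛG ΛK)) +
      exp (-(t / 3 * setDistEdges ΛF ΛH)) * exp (-(t / 3 * setDistEdges ΛH ΛK)) * exp (-(t / 3 * setDistEdges ΛG ΛK)) +
      exp (-(t / 3 * setDistEdges ΛF ΛK)) * exp (-(t / 3 * setDistEdges ΛG ΛK)) * exp (-(t / 3 * setDistEdges ΛG ΛH)) +
      exp (-(t / 3 * setDistEdges ΛF ΛK)) * exp (-(t / 3 * setDistEdges ΛH ΛK)) * exp (-(t / 3 * setDistEdges ΛG ΛH)) +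
      exp (-(t / 3 * setDistEdges ΛF ΛG)) * exp (-(t / 3 * setDistEdges ΛF ΛH)) * exp (-(t / 3 * setDistEdges ΛH ΛK)) +
      exp (-(t / 3 * setDistEdges ΛF ΛG)) * exp (-(t / 3 * setDistEdges ΛF ΛK)) * exp (-(t / 3 * setDistEdges ΛH ΛK)) +
      exp (-(t / 3 * setDistEdges ΛF ΛH)) * exp (-(t / 3 * setDistEdges ΛF ΛG)) * exp (-(t / 3 * setDistEdges ΛG ΛK)) +
      exp (-(t / 3 * setDistEdges ΛF ΛH)) * exp (-(t / 3 * setDistEdges ΛF ΛK)) * exp (-(t / 3 * setDistEdges ΛG ΛK)) +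
      exp (-(t / 3 * setDistEdges ΛF ΛK)) * exp (-(t / 3 * setDistEdges ΛF ΛG)) * exp (-(t / 3 * setDistEdges ΛG ΛH)) +
      exp (-(t / 3 * setDistEdges ΛF ΛK)) * exp (-(t / 3 * setDistEdges ΛF ΛH)) * exp (-(t / 3 * setDistEdges ΛG ΛH))) := by
  classical
  have hc : (0 : ℝ) ≤ 2 / 3 := by norm_num
  have hP : ∀ B : Matrix (Fin 2) (Fin 2) ℂ, matrixOpNorm B ≤ |βW / 4| * (2 * (((4 : ℕ) : ℝ) - 1)) →
      ∀ (ψ : Matrix.specialUnitaryGroup (Fin 2) ℂ → ℝ) (M : ℝ), 0 ≤ M →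
        (∀ x y, |ψ x - ψ y| ≤ M * suFrobDist x y) →
        Var[ψ; (haarProbability (Matrix.specialUnitaryGroup (Fin 2) ℂ)).tilted
          fun g => ((2 : ℕ) : ℝ) * ((g : Matrix (Fin 2) (Fin 2) ℂ) * B).trace.re] ≤ 2 / 3 * M ^ 2 :=
    fun B hB ψ M hM hψ => oneLinkPoincareSUN_two_sharp _ B hB ψ M hM hψ
  have hVB := linVariance_of_poincare (N := 2) hP
  have hv : (0 : ℝ) ≤ 2 / 3 * ((2 : ℕ) : ℝ) ^ 2 := by norm_num
  have hsq : Real.sqrt (2 / 3 * (2 / 3 * ((2 : ℕ) : ℝ) ^ 2)) = 4 / 3 := by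
    rw [show (2 / 3 * (2 / 3 * ((2 : ℕ) : ℝ) ^ 2) : ℝ) = (4 / 3) ^ 2 by norm_num, Real.sqrt_sq (by norm_num)]
  have hρ' : 6 * (((4 : ℕ) : ℝ) - 1) * |βW / 4| * (exp a * exp t * Real.sqrt (2 / 3 * (2 / 3 * ((2 : ℕ) : ℝ) ^ 2))) +
      exp (a / 2) * Real.sqrt (2 / 3) * Λ < 1 := by
    rw [hsq, abs_div, abs_of_pos (by norm_num : (0 : ℝ) < 4)]
    have : 6 * (((4 : ℕ) : ℝ) - 1) * (|βW| / 4) * (exp a * exp t * (4 / 3)) = 6 * |βW| * (exp a * exp t) := by norm_num; ring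
    rw [this]; exact hρ
  have hμ' : μ ∈ perturbedGibbsMeasuresS (d := 4) (fundamentalRep (Fin 2)) ((2 : ℕ) * (βW / 4)) W := by simpa using hμ
  have hA : ∀ a b : Matrix.specialUnitaryGroup (Fin 2) ℂ, dist (suEntries a) (suEntries b) ≤ 1 * suFrobDist a b :=
    fun a b => by rw [one_mul]; exact dist_suEntries_le_suFrobDist a b
  have hsum : ∀ (Λ₀ : Finset (ZdEdge 4)) (K₀ : ℝ≥0), ((Λ₀.card : ℝ) * K₀) = ∑ y ∈ Λ₀, (if y ∈ Λ₀ then (1 : ℝ) * (K₀ : ℝ) else 0) :=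
    fun Λ₀ K₀ => by rw [Finset.sum_congr rfl fun y hy => by rw [if_pos hy, one_mul], Finset.sum_const, nsmul_eq_mul]
  have key := abs_fourPoint_le_tree_S (N := 2) (d := 4) (by norm_num) (by norm_num) hc hv le_rfl hP hVB ht hρ' hW hμ' hF.measurable
    hF.dependsOn hMF (hF.isLipBound zero_le_one hA) hG.measurable hG.dependsOn hMG (hG.isLipBound zero_le_one hA) hH.measurable hH.dependsOn
    hMH (hH.isLipBound zero_le_one hA) hK.measurable hK.dependsOn hMK (hK.isLipBound zero_le_one hA) (hsum ΛF KF) (hsum ΛG KG) (hsum ΛH KH)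
    (hsum ΛK KK)
  refine key.trans (le_of_eq ?_)
  norm_num

/-- ★ **THE `SU(2)` WILSON STATE ON `ℤ⁴`: TREE DECAY OF THE FOURTH CUMULANT ON THE TWO-SIDED WINDOW.**  For every `β_W` and `t ≥ 0` with
`6|β_W| e^{t} < 1` (every `|β_W| < 1/6` qualifies with any rate `t < log(1/(6|β_W|))`), EVERY DLR state `μ` of the Wilson action at bare coupling `β_W/2`
and Lipschitz cylinders `F, G, H, K`: `|u₄(F; G; H; K)| ≤ 96 · B₄ · Σ_{16 trees} Π_e e^{−(t/3) d_e}`. -/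
theorem su2_wilson_abs_fourPoint_le_tree {βW t : ℝ} (ht : 0 ≤ t) (hβ : 6 * |βW| * exp t < 1)
    {μ : Measure (LGConfig 4 (Matrix.specialUnitaryGroup (Fin 2) ℂ))}
    (hμ : μ ∈ perturbedGibbsMeasuresS (d := 4) (fundamentalRep (Fin 2)) (2 * (βW / 4)) 0)
    {F : LGConfig 4 (Matrix.specialUnitaryGroup (Fin 2) ℂ) → ℝ} {ΛF : Finset (ZdEdge 4)} {KF : ℝ≥0}
    (hF : IsLipschitzCylinder (fundamentalRep (Fin 2)) F ΛF KF) {MF : ℝ} (hMF : ∀ σ, |F σ| ≤ MF)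
    {G : LGConfig 4 (Matrix.specialUnitaryGroup (Fin 2) ℂ) → ℝ} {ΛG : Finset (ZdEdge 4)} {KG : ℝ≥0}
    (hG : IsLipschitzCylinder (fundamentalRep (Fin 2)) G ΛG KG) {MG : ℝ} (hMG : ∀ σ, |G σ| ≤ MG)
    {H : LGConfig 4 (Matrix.specialUnitaryGroup (Fin 2) ℂ) → ℝ} {ΛH : Finset (ZdEdge 4)} {KH : ℝ≥0}
    (hH : IsLipschitzCylinder (fundamentalRep (Fin 2)) H ΛH KH) {MH : ℝ} (hMH : ∀ σ, |H σ| ≤ MH)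
    {K : LGConfig 4 (Matrix.specialUnitaryGroup (Fin 2) ℂ) → ℝ} {ΛK : Finset (ZdEdge 4)} {KK : ℝ≥0}
    (hK : IsLipschitzCylinder (fundamentalRep (Fin 2)) K ΛK KK) {MK : ℝ} (hMK : ∀ σ, |K σ| ≤ MK) :
    |U₄[F ; G ; H ; K ; μ]| ≤
      96 * ((MF * MG * (ΛH.card * KH) + MF * MH * (ΛG.card * KG) + MG * MH * (ΛF.card * KF)) * (ΛK.card * KK) +
        (MF * MG * (ΛK.card * KK) + MF * MK * (ΛG.card * KG) + MG * MK * (ΛF.card * KF)) * (ΛH.card * KH) +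
        (MF * MH * (ΛK.card * KK) + MF * MK * (ΛH.card * KH) + MH * MK * (ΛF.card * KF)) * (ΛG.card * KG) +
        (MG * MH * (ΛK.card * KK) + MG * MK * (ΛH.card * KH) + MH * MK * (ΛG.card * KG)) * (ΛF.card * KF) +
        (MF * (ΛG.card * KG) + MG * (ΛF.card * KF)) * (MH * (ΛK.card * KK) + MK * (ΛH.card * KH)) + (MF * (ΛH.card * KH) + MH * (ΛF.card * KF)) * (MG * (ΛK.card * KK) + MK * (ΛG.card * KG)) + (MF * (ΛK.card * KK) + MK * (ΛF.card * KF)) * (MG * (ΛH.card * KH) + MH * (ΛG.card * KG))) *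
      (exp (-(t / 3 * setDistEdges ΛF ΛG)) * exp (-(t / 3 * setDistEdges ΛF ΛH)) * exp (-(t / 3 * setDistEdges ΛF ΛK)) +
      exp (-(t / 3 * setDistEdges ΛF ΛG)) * exp (-(t / 3 * setDistEdges ΛG ΛH)) * exp (-(t / 3 * setDistEdges ΛG ΛK)) +
      exp (-(t / 3 * setDistEdges ΛF ΛH)) * exp (-(t / 3 * setDistEdges ΛG ΛH)) * exp (-(t / 3 * setDistEdges ΛH ΛK)) +
      exp (-(t / 3 * setDistEdges ΛF ΛK)) * exp (-(t / 3 * setDistEdges ΛG ΛK)) * exp (-(t / 3 * setDistEdges ΛH ΛK)) +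
      exp (-(t / 3 * setDistEdges ΛF ΛG)) * exp (-(t / 3 * setDistEdges ΛG ΛH)) * exp (-(t / 3 * setDistEdges ΛH ΛK)) +
      exp (-(t / 3 * setDistEdges ΛF ΛG)) * exp (-(t / 3 * setDistEdges ΛG ΛK)) * exp (-(t / 3 * setDistEdges ΛH ΛK)) +
      exp (-(t / 3 * setDistEdges ΛF ΛH)) * exp (-(t / 3 * setDistEdges ΛG ΛH)) * exp (-(t / 3 * setDistEdges ΛG ΛK)) +
      exp (-(t / 3 * setDistEdges ΛF ΛH)) * exp (-(t / 3 * setDistEdges ΛH ΛK)) * exp (-(t / 3 * setDistEdges ΛG ΛK)) +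
      exp (-(t / 3 * setDistEdges ΛF ΛK)) * exp (-(t / 3 * setDistEdges ΛG ΛK)) * exp (-(t / 3 * setDistEdges ΛG ΛH)) +
      exp (-(t / 3 * setDistEdges ΛF ΛK)) * exp (-(t / 3 * setDistEdges ΛH ΛK)) * exp (-(t / 3 * setDistEdges ΛG ΛH)) +
      exp (-(t / 3 * setDistEdges ΛF ΛG)) * exp (-(t / 3 * setDistEdges ΛF ΛH)) * exp (-(t / 3 * setDistEdges ΛH ΛK)) +
      exp (-(t / 3 * setDistEdges ΛF ΛG)) * exp (-(t / 3 * setDistEdges ΛF ΛK)) * exp (-(t / 3 * setDistEdges ΛH ΛK)) +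
      exp (-(t / 3 * setDistEdges ΛF ΛH)) * exp (-(t / 3 * setDistEdges ΛF ΛG)) * exp (-(t / 3 * setDistEdges ΛG ΛK)) +
      exp (-(t / 3 * setDistEdges ΛF ΛH)) * exp (-(t / 3 * setDistEdges ΛF ΛK)) * exp (-(t / 3 * setDistEdges ΛG ΛK)) +
      exp (-(t / 3 * setDistEdges ΛF ΛK)) * exp (-(t / 3 * setDistEdges ΛF ΛG)) * exp (-(t / 3 * setDistEdges ΛG ΛH)) +
      exp (-(t / 3 * setDistEdges ΛF ΛK)) * exp (-(t / 3 * setDistEdges ΛF ΛH)) * exp (-(t / 3 * setDistEdges ΛG ΛH))) := by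
  have hρ : 6 * |βW| * (exp 0 * exp t) + exp (0 / 2) * Real.sqrt (2 / 3) * 0 < 1 := by simpa using hβ
  exact su2_abs_fourPoint_le_tree_dim4 ht hρ (memBallZdS_zero le_rfl le_rfl) hμ hF hMF hG hMG hH hMH hK hMK

end Summit.Ventures.YMGap.RobustBall

end
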